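/-
Copyright (c) 2026. Released under Apache 2.0 license.
-/
import Literature.NumberTheory.ModularForms.ModularGroupAbelianization
import Mathlib.NumberTheory.ModularForms.CongruenceSubgroups
import HarnessLib

/-!
# The commutator subgroup of `SL₂(ℤ)` is a congruence subgroup of level `12`

Reiner [Reiner1955RealLinearCharacters, §2] describes `Γ' = [SL₂(ℤ), SL₂(ℤ)]` "by means of congruences"
(`Γ' = K₃ ∩ K₄`, pulled back from `SL₂(𝔽₃) ⊳ Q₈` and `SL₂(ℤ/4)`); the tree's
`Literature.NumberTheory.ModularForms.SL2Z.mem_commutator_iff_twelve_dvd_etaSqExp` gives the equivalent criterion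
`γ ∈ Γ' ↔ 12 ∣ e(γ)` with the polynomial `e(a b; c d) = (1 - c²)(bd + 3(c-1)d + c + 3) + c(a + d - 3)`.  Since
`e` only depends on the entries modulo `12`, this file records the consequences in Mathlib's language of
congruence subgroups:

* `Gamma_twelve_le_commutator` — **`Γ(12) ≤ [SL₂(ℤ), SL₂(ℤ)]`**; `isCongruenceSubgroup_commutator`;
* `Gamma_le_commutator_iff` — for `N ≠ 0`, `Γ(N) ≤ Γ'` iff `12 ∣ N` (the level of `Γ'` is exactly `12`);
* `map_eq_one_of_mem_Gamma_twelve` — every homomorphism from `SL₂(ℤ)` to a commutative group kills `Γ(12)`;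
* `Gamma_mul_le_inf_commutator` — `Γ(12N) ≤ Γ(N) ⊓ Γ'`.

This is the case `N = 1` of «`[SL₂(ℤ), Γ(N)]` is a congruence subgroup», the group-theoretic content of the
invariant form of [CalegariDimitrovTang2025, Cor. 4.5.3] (`UnboundedDenominatorsCor453Reduction`); the general
level is Beyl's computation of the Schur multiplier of `SL₂(ℤ/N)` [Beyl1986] and is NOT here.
-/

open scoped MatrixGroups

namespace Literature.NumberTheory.ModularForms.SL2Z

open CongruenceSubgroup Matrix.SpecialLinearGroup
open Literature.NumberTheory.EllipticCurves.ModularForms (etaSqExp)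

/-- The exponent `e(γ)` modulo `12` only depends on the entries of `γ` modulo `12`: if `γ ≡ 1 (mod 12)` then
`12 ∣ e(γ)` (`e(1) = 0`). [cite: Reiner1955RealLinearCharacters, §2] -/
theorem twelve_dvd_etaSqExp_of_mem_Gamma {γ : SL(2, ℤ)} (hγ : γ ∈ Gamma 12) :
    (12 : ℤ) ∣ etaSqExp (γ 0 0) (γ 0 1) (γ 1 0) (γ 1 1) := by
  obtain ⟨h00, h01, h10, h11⟩ := Gamma_mem.mp hγ
  have hz : ((etaSqExp (γ 0 0) (γ 0 1) (γ 1 0) (γ 1 1) : ℤ) : ZMod 12) = 0 := by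
    simp only [etaSqExp]
    push_cast
    rw [h00, h01, h10, h11]
    ring
  exact_mod_cast (ZMod.intCast_zmod_eq_zero_iff_dvd _ 12).mp hz

/-- **`Γ(12) ≤ [SL₂(ℤ), SL₂(ℤ)]`**: the commutator subgroup of the modular group contains the principal
congruence subgroup of level `12`. [cite: Reiner1955RealLinearCharacters, §2] -/
theorem Gamma_twelve_le_commutator : Gamma 12 ≤ commutator SL(2, ℤ) := fun _ hγ ↦
  (mem_commutator_iff_twelve_dvd_etaSqExp _).mpr (twelve_dvd_etaSqExp_of_mem_Gamma hγ)

/-- The commutator subgroup of `SL₂(ℤ)` is a congruence subgroup. [cite: Reiner1955RealLinearCharacters, §2] -/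
theorem isCongruenceSubgroup_commutator : IsCongruenceSubgroup (commutator SL(2, ℤ)) :=
  ⟨12, by norm_num, Gamma_twelve_le_commutator⟩

/-- `Γ(L) ≤ Γ(M)` for `M ∣ L`. [folklore] -/
private theorem Gamma_le_Gamma_of_dvd {M L : ℕ} (h : M ∣ L) : Gamma L ≤ Gamma M := by
  intro γ hγ
  obtain ⟨h00, h01, h10, h11⟩ := Gamma_mem.mp hγ
  have cast_eq : ∀ a : ℤ, ((a : ZMod L).cast : ZMod M) = (a : ZMod M) := fun a ↦
    ZMod.cast_intCast h a
  rw [Gamma_mem]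
  refine ⟨?_, ?_, ?_, ?_⟩
  · rw [← cast_eq, h00, ZMod.cast_one h]
  · rw [← cast_eq, h01, ZMod.cast_zero]
  · rw [← cast_eq, h10, ZMod.cast_zero]
  · rw [← cast_eq, h11, ZMod.cast_one h]

/-- **The level of `[SL₂(ℤ), SL₂(ℤ)]` is exactly `12`**: for `N ≠ 0`, `Γ(N) ≤ Γ'` iff `12 ∣ N`
(`⇐`: `Γ(N) ≤ Γ(12)`; `⇒`: `T^N ∈ Γ(N)` and `T^N ∈ Γ' ↔ 12 ∣ N`). [cite: Reiner1955RealLinearCharacters, §2] -/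
theorem Gamma_le_commutator_iff {N : ℕ} (hN : N ≠ 0) : Gamma N ≤ commutator SL(2, ℤ) ↔ 12 ∣ N := by
  constructor
  · intro h
    have hT : (ModularGroup.T : SL(2, ℤ)) ^ (N : ℤ) ∈ Gamma N := by
      simpa using ModularGroup_T_pow_mem_Gamma N N (dvd_refl _)
    have h12 := (T_zpow_mem_commutator_iff (N : ℤ)).mp (h hT)
    exact_mod_cast h12
  · intro h
    have _ := hN
    exact (Gamma_le_Gamma_of_dvd h).trans Gamma_twelve_le_commutator

/-- Every homomorphism from `SL₂(ℤ)` to a commutative group is trivial on `Γ(12)`.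
[cite: Reiner1955RealLinearCharacters, §2] -/
theorem map_eq_one_of_mem_Gamma_twelve {A : Type*} [CommGroup A] (f : SL(2, ℤ) →* A) {γ : SL(2, ℤ)}
    (hγ : γ ∈ Gamma 12) : f γ = 1 :=
  Abelianization.commutator_subset_ker f (Gamma_twelve_le_commutator hγ)

/-- For every `N`, `Γ(12 N) ≤ Γ(N) ⊓ [SL₂(ℤ), SL₂(ℤ)]`. [cite: Reiner1955RealLinearCharacters, §2] -/
theorem Gamma_mul_le_inf_commutator (N : ℕ) :
    Gamma (12 * N) ≤ Gamma N ⊓ commutator SL(2, ℤ) := fun _ hγ ↦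
  Subgroup.mem_inf.mpr ⟨Gamma_le_Gamma_of_dvd (dvd_mul_left N 12) hγ,
    Gamma_twelve_le_commutator (Gamma_le_Gamma_of_dvd (dvd_mul_right 12 N) hγ)⟩

end Literature.NumberTheory.ModularForms.SL2Z
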